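import Literature.NumberTheory.LFunctions.Zhang2022.Section5Lemma54DeltaDeriv

/-!
# Zhang (2022), §5: a UNIFORM bound for `Δ′` — `‖Δ′(x)‖ ≤ 8π√π·e^{9/(8𝓛₂²)}·𝓛₂⁻²` for every real `x`
# (the «`Δ′` bound (p3)» of the dual evaluation of (7.18)–(7.21), rung F-S3 §D, cell landau-siegel)

Topic `Literature/NumberTheory/LFunctions/Zhang2022` (Landau–Siegel audit tree; verdict-neutral).
Y. Zhang, *Discrete mean estimates and the Landau–Siegel zero*, arXiv:2211.02515v1 (2022)
[Zhang2022LandauSiegel] — **an unrefereed manuscript under adjudication; nothing here asserts or denies its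
Theorems 1–2. The programme SEARCHES and TYPES; no claim about Landau–Siegel zeros, Theorems 1–2 of
arXiv:2211.02515 or a repaired Margin232 until a kernel theorem says so.**

The manuscript only gestures at derivative bounds for `Δ` («some upper bounds for `Δ″(x)` analogous to Lemma 5.3
can be obtained», §5 p. 10, proof of Lemma 5.4, [p0010 L283–L289]). The cell's dual (l₂-first) evaluation of the
main-term step (7.18)–(7.21) for the long `𝒳₂` datum (desk note `ls-ref-1/D5d-iii-DUAL-v1.md` §3(A); ls-knife-crit-1
2026-08-27T17:21:01Z precision (p3); M-RULEBOOK (D5‴)(iii′)) needs exactly ONE non-verbatim input: a bound for the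
total variation of the weight `l₂ ↦ Δ(l₁l₂/(pk))` on a window, i.e. a UNIFORM bound for `Δ′` — booked as
«`Delta_deriv_bound`: `|Δ′| ≪ 𝓛₂⁻²` uniformly, S-sized, (A)-free». This file PROVES it, with `Δ` read through (5.10)
(`Lemma53.Delta510`, as everywhere in the tree) and `Δ′ = ∫ (−2πi(e^u−1)) e^{phase(x,u)} du`
(`Lemma53.deriv_Delta510`, p. 11 proof of Lemma 5.4, kernel file `Section5Lemma54DeltaDeriv`):

* (private) `|e^u − 1| ≤ |u|·e^{|u|}` and `|u|·e^{−(L²/4)u²} ≤ 2/L` (`L > 0`) [folklore];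
* `norm_dfac_mul_cexp_phase_le_gauss` — the Gaussian majorant, uniform in `x` and `t₀`:
  `‖(−2πi(e^u−1))·e^{phase(x,u)}‖ ≤ (4π/L)·e^{9/(8L²)}·e^{−(L²/4)u²}` (`|e^{phase}| = e^{u/2 − L²u²}`,
  `(3/2)|u| ≤ (L²/2)u² + 9/(8L²)`, and the previous two items);
* **`norm_deriv_Delta510_le`** — `‖Δ′(x)‖ ≤ 8π√π·e^{9/(8L²)}/L²` for `L > 0` (`∫ e^{−(L²/4)u²} du = 2√π/L`,
  Mathlib's `integral_gaussian`); **`norm_deriv_Delta510_le_of_two_le`** — `‖Δ′(x)‖ ≤ 84/L²` for `L ≥ 2`;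
* `norm_Delta510_sub_le` — the Lipschitz form `‖Δ(z) − Δ(y)‖ ≤ (84/L²)·|z − y|` (mean value inequality);
* **`sum_norm_Delta510_sample_sub_le`** — the discrete-variation form the `χ`-window lemma consumes
  (hypothesis shape `hGv` of `WindowHyperbola.norm_window_chi_conv_le`): for every step `c` and every `N′ < M′`,
  `Σ_{n ∈ Ioo N′ M′} ‖Δ(c·n) − Δ(c·(n+1))‖ ≤ (84/L²)·|c|·#Ioo N′ M′`. In the cell (`c = l₁/(pk)`, window of
  `2𝓛₁pk/l₁` integers, `L = 𝓛₂ = 𝓛⁴⁰⁰`, `𝓛₁ = 𝓛⁴⁰⁵`) this is `TV ≤ 168·𝓛₁/𝓛₂² = O(𝓛⁻³⁹⁵)`, the number of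
  (p2) of the record.

No zero-free region, no Siegel-type hypothesis, no `t₀/ε₁/δ(s)` input beyond the definition (5.10); the bounds are
uniform in `t₀` and `x`. The constants are not optimised (`8π√π·e^{9/32} ≈ 59`; `84` after rounding `π < 3.15`,
`√π < 2`, `e^{1/2} < 1.65`).

## References

* Y. Zhang, arXiv:2211.02515v1 (2022), §5 (5.10) p. 10; Lemma 5.3 (5.8)–(5.9); proof of Lemma 5.4 p. 10–11
  («upper bounds for `Δ″` analogous to Lemma 5.3»); §7 (7.17)–(7.21) p. 15 (the weight `Δ(l₁l₂/(pk))`).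
  [cite: Zhang2022LandauSiegel, §5 (5.10), Lemma 5.4 (proof); §7 (7.18)–(7.21)]
-/

noncomputable section

open Complex Real Set MeasureTheory Filter Topology

namespace Literature.NumberTheory.LFunctions.Zhang2022

namespace Lemma53

/-! ### Two elementary real inequalities -/

/-- `|e^u − 1| ≤ |u|·e^{|u|}` for every real `u`. [folklore] -/
private theorem abs_exp_sub_one_le_abs_mul_exp_abs (u : ℝ) :
    |Real.exp u - 1| ≤ |u| * Real.exp |u| := by
  rcases le_or_gt 0 u with hu | hu
  · have h0 : 0 ≤ Real.exp u - 1 := by linarith [Real.add_one_le_exp u]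
    rw [abs_of_nonneg h0, abs_of_nonneg hu]
    have h1 : (1 - u) * Real.exp u ≤ 1 := by
      calc (1 - u) * Real.exp u ≤ Real.exp (-u) * Real.exp u :=
            mul_le_mul_of_nonneg_right (by linarith [Real.add_one_le_exp (-u)]) (Real.exp_pos u).le
        _ = 1 := by rw [← Real.exp_add]; simp
    nlinarith [Real.exp_pos u]
  · have h1 : Real.exp u ≤ 1 := Real.exp_le_one_iff.mpr hu.le
    rw [abs_of_nonpos (by linarith), abs_of_neg hu]
    have h2 := Real.add_one_le_exp u
    have h3 : 1 ≤ Real.exp (-u) := Real.one_le_exp (by linarith)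
    nlinarith

/-- `|u|·e^{−(L²/4)u²} ≤ 2/L` for `L > 0` (`|u| ≤ 2/L + (L/2)u² ≤ (2/L)(1 + (L²/4)u²) ≤ (2/L)e^{(L²/4)u²}`).
[folklore] -/
private theorem abs_mul_exp_neg_le {L : ℝ} (hL : 0 < L) (u : ℝ) :
    |u| * Real.exp (-(L ^ 2 / 4) * u ^ 2) ≤ 2 / L := by
  have hE : 1 + L ^ 2 / 4 * u ^ 2 ≤ Real.exp (L ^ 2 / 4 * u ^ 2) := by
    linarith [Real.add_one_le_exp (L ^ 2 / 4 * u ^ 2)]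
  have hsq : |u| ^ 2 = u ^ 2 := sq_abs u
  -- `|u| ≤ (2/L)(1 + (L²/4)u²)`: `(2/L)(1 + L²u²/4) − |u| = ((L|u| − 1)² + 3)/(2L) ≥ 0`
  have h1 : |u| ≤ 2 / L * (1 + L ^ 2 / 4 * u ^ 2) := by
    rw [← hsq]
    have key : 2 / L * (1 + L ^ 2 / 4 * |u| ^ 2) - |u| = ((L * |u| - 1) ^ 2 + 3) / (2 * L) := by
      field_simp
      ring
    have : 0 ≤ ((L * |u| - 1) ^ 2 + 3) / (2 * L) := by positivity
    linarith
  have h2 : |u| ≤ 2 / L * Real.exp (L ^ 2 / 4 * u ^ 2) :=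
    h1.trans (mul_le_mul_of_nonneg_left hE (by positivity))
  have hpos : 0 < Real.exp (L ^ 2 / 4 * u ^ 2) := Real.exp_pos _
  rw [show -(L ^ 2 / 4) * u ^ 2 = -(L ^ 2 / 4 * u ^ 2) by ring, Real.exp_neg]
  rw [← div_eq_mul_inv, div_le_iff₀ hpos]
  exact h2

/-! ### The Gaussian majorant of the integrand of `Δ′`, uniform in `x` and `t₀` -/

/-- `‖−2πi(e^u − 1)‖ = 2π|e^u − 1|` for real `u` (the factor produced by one `x`-derivative of the integrand of
(5.10)). [cite: Zhang2022LandauSiegel, §5 (5.10), Lemma 5.4 (proof)] -/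
theorem norm_dfac_eq (u : ℝ) : ‖dfac u‖ = 2 * π * |Real.exp u - 1| := by
  rw [dfac_def, norm_neg, ← Complex.ofReal_exp, ← Complex.ofReal_one, ← Complex.ofReal_sub,
    norm_mul, norm_mul, norm_mul, Complex.norm_I, mul_one, Complex.norm_two, Complex.norm_real,
    Complex.norm_real, Real.norm_eq_abs, Real.norm_eq_abs, abs_of_pos Real.pi_pos]

/-- **Gaussian majorant:** `‖(−2πi(e^u−1))·e^{phase(x,u)}‖ ≤ (4π/L)·e^{9/(8L²)}·e^{−(L²/4)u²}` for `L > 0`,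
every `t₀`, `x`, `u` (`|e^{phase}| = e^{u/2 − L²u²}`, `|e^u − 1| ≤ |u|e^{|u|}`, `(3/2)|u| ≤ (L²/2)u² + 9/(8L²)`,
`|u|e^{−(L²/4)u²} ≤ 2/L`). [cite: Zhang2022LandauSiegel, §5 (5.10), Lemma 5.4 (proof)] -/
theorem norm_dfac_mul_cexp_phase_le_gauss {L₂ : ℝ} (hL : 0 < L₂) (t₀ x u : ℝ) :
    ‖dfac u ^ 1 * cexp (phase L₂ t₀ x u)‖ ≤
      4 * π / L₂ * Real.exp (9 / (8 * L₂ ^ 2)) * Real.exp (-(L₂ ^ 2 / 4) * u ^ 2) := by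
  rw [pow_one, norm_mul, norm_cexp_phase_ofReal, norm_dfac_eq]
  have hπ : 0 < π := Real.pi_pos
  -- step 1: `|e^u − 1|·e^{u/2 − L²u²} ≤ |u|·e^{(3/2)|u| − L²u²}`
  have h1 : |Real.exp u - 1| * Real.exp (u / 2 - L₂ ^ 2 * u ^ 2) ≤
      |u| * Real.exp (3 / 2 * |u| - L₂ ^ 2 * u ^ 2) := by
    have ha := abs_exp_sub_one_le_abs_mul_exp_abs u
    have hb : Real.exp |u| * Real.exp (u / 2 - L₂ ^ 2 * u ^ 2) ≤
        Real.exp (3 / 2 * |u| - L₂ ^ 2 * u ^ 2) := by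
      rw [← Real.exp_add]
      exact Real.exp_le_exp.mpr (by linarith [le_abs_self u])
    calc |Real.exp u - 1| * Real.exp (u / 2 - L₂ ^ 2 * u ^ 2)
        ≤ |u| * Real.exp |u| * Real.exp (u / 2 - L₂ ^ 2 * u ^ 2) :=
          mul_le_mul_of_nonneg_right ha (Real.exp_pos _).le
      _ = |u| * (Real.exp |u| * Real.exp (u / 2 - L₂ ^ 2 * u ^ 2)) := by ring
      _ ≤ |u| * Real.exp (3 / 2 * |u| - L₂ ^ 2 * u ^ 2) :=
          mul_le_mul_of_nonneg_left hb (abs_nonneg u)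
  -- step 2: `(3/2)|u| − L²u² ≤ 9/(8L²) − (L²/4)u² − (L²/4)u²`
  have h2 : 3 / 2 * |u| - L₂ ^ 2 * u ^ 2 ≤
      9 / (8 * L₂ ^ 2) + (-(L₂ ^ 2 / 4) * u ^ 2) + (-(L₂ ^ 2 / 4) * u ^ 2) := by
    have hsq : |u| ^ 2 = u ^ 2 := sq_abs u
    have hL2 : 0 < L₂ ^ 2 := by positivity
    -- `(L²/2)u² − (3/2)|u| + 9/(8L²) = (L|u| − 3/(2L))²/2 ≥ 0`
    have key : 0 ≤ L₂ ^ 2 / 2 * u ^ 2 - 3 / 2 * |u| + 9 / (8 * L₂ ^ 2) := by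
      have : L₂ ^ 2 / 2 * u ^ 2 - 3 / 2 * |u| + 9 / (8 * L₂ ^ 2) = (L₂ * |u| - 3 / (2 * L₂)) ^ 2 / 2 := by
        rw [← hsq]; field_simp; ring
      rw [this]; positivity
    linarith
  -- step 3: assemble with `|u|e^{−(L²/4)u²} ≤ 2/L`
  have h3 : |u| * Real.exp (3 / 2 * |u| - L₂ ^ 2 * u ^ 2) ≤
      2 / L₂ * Real.exp (9 / (8 * L₂ ^ 2)) * Real.exp (-(L₂ ^ 2 / 4) * u ^ 2) := by
    calc |u| * Real.exp (3 / 2 * |u| - L₂ ^ 2 * u ^ 2)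
        ≤ |u| * Real.exp (9 / (8 * L₂ ^ 2) + (-(L₂ ^ 2 / 4) * u ^ 2) + (-(L₂ ^ 2 / 4) * u ^ 2)) :=
          mul_le_mul_of_nonneg_left (Real.exp_le_exp.mpr h2) (abs_nonneg u)
      _ = Real.exp (9 / (8 * L₂ ^ 2)) * (|u| * Real.exp (-(L₂ ^ 2 / 4) * u ^ 2)) *
            Real.exp (-(L₂ ^ 2 / 4) * u ^ 2) := by rw [Real.exp_add, Real.exp_add]; ring
      _ ≤ Real.exp (9 / (8 * L₂ ^ 2)) * (2 / L₂) * Real.exp (-(L₂ ^ 2 / 4) * u ^ 2) :=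
          mul_le_mul_of_nonneg_right
            (mul_le_mul_of_nonneg_left (abs_mul_exp_neg_le hL u) (Real.exp_pos _).le)
            (Real.exp_pos _).le
      _ = 2 / L₂ * Real.exp (9 / (8 * L₂ ^ 2)) * Real.exp (-(L₂ ^ 2 / 4) * u ^ 2) := by ring
  calc 2 * π * |Real.exp u - 1| * Real.exp (u / 2 - L₂ ^ 2 * u ^ 2)
      = 2 * π * (|Real.exp u - 1| * Real.exp (u / 2 - L₂ ^ 2 * u ^ 2)) := by ring
    _ ≤ 2 * π * (2 / L₂ * Real.exp (9 / (8 * L₂ ^ 2)) * Real.exp (-(L₂ ^ 2 / 4) * u ^ 2)) :=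
        mul_le_mul_of_nonneg_left (h1.trans h3) (by positivity)
    _ = 4 * π / L₂ * Real.exp (9 / (8 * L₂ ^ 2)) * Real.exp (-(L₂ ^ 2 / 4) * u ^ 2) := by ring

/-! ### The uniform bound for `Δ′` -/

/-- `∫ e^{−(L²/4)u²} du = 2√π/L` (`L > 0`). [folklore] -/
private theorem integral_exp_neg_quarter_sq {L : ℝ} (hL : 0 < L) :
    ∫ u : ℝ, Real.exp (-(L ^ 2 / 4) * u ^ 2) = 2 * Real.sqrt π / L := by
  rw [integral_gaussian]
  have h : π / (L ^ 2 / 4) = (2 * Real.sqrt π / L) ^ 2 := by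
    rw [div_pow, mul_pow, Real.sq_sqrt Real.pi_pos.le]
    field_simp
    ring
  rw [h, Real.sqrt_sq (by positivity)]

/-- **`Δ′` bound, symbolic form** («`Delta_deriv_bound`» (p3) of the cell's record): for `𝓛₂ = L > 0` and all
real `t₀`, `x`, `‖Δ′(x)‖ ≤ 8π√π·e^{9/(8L²)}/L²`, `Δ` = (5.10) (`Lemma53.Delta510 L t₀`). Proof: `Δ′ = ∫(−2πi(e^u−1))
e^{phase}` (`deriv_Delta510`), the Gaussian majorant `norm_dfac_mul_cexp_phase_le_gauss`, and `∫e^{−(L²/4)u²} = 2√π/L`.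
[cite: Zhang2022LandauSiegel, §5 (5.10), Lemma 5.4 (proof)] -/
theorem norm_deriv_Delta510_le {L₂ : ℝ} (hL : 0 < L₂) (t₀ x : ℝ) :
    ‖deriv (Delta510 L₂ t₀) x‖ ≤ 8 * π * Real.sqrt π * Real.exp (9 / (8 * L₂ ^ 2)) / L₂ ^ 2 := by
  rw [deriv_Delta510 hL.ne' t₀]
  dsimp only
  rw [phaseInt_def]
  have hint : Integrable fun u : ℝ =>
      4 * π / L₂ * Real.exp (9 / (8 * L₂ ^ 2)) * Real.exp (-(L₂ ^ 2 / 4) * u ^ 2) :=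
    (integrable_exp_neg_mul_sq (by positivity : 0 < L₂ ^ 2 / 4)).const_mul _
  refine (norm_integral_le_of_norm_le hint
    (Eventually.of_forall fun u => norm_dfac_mul_cexp_phase_le_gauss hL t₀ x u)).trans ?_
  rw [integral_const_mul, integral_exp_neg_quarter_sq hL]
  apply le_of_eq
  field_simp
  ring

/-- **`Δ′` bound, numeric form:** for `L = 𝓛₂ ≥ 2` and all real `t₀`, `x`: `‖Δ′(x)‖ ≤ 84/L²`
(`π < 3.15`, `√π < 2`, `e^{9/(8L²)} ≤ e^{1/2} < 1.65`). [cite: Zhang2022LandauSiegel, §5 (5.10), Lemma 5.4 (proof)] -/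
theorem norm_deriv_Delta510_le_of_two_le {L₂ : ℝ} (hL : 2 ≤ L₂) (t₀ x : ℝ) :
    ‖deriv (Delta510 L₂ t₀) x‖ ≤ 84 / L₂ ^ 2 := by
  have hL0 : 0 < L₂ := by linarith
  refine (norm_deriv_Delta510_le hL0 t₀ x).trans ?_
  have hπ : π < 3.15 := Real.pi_lt_d2
  have hsqπ : Real.sqrt π < 2 := by
    rw [Real.sqrt_lt' (by norm_num : (0:ℝ) < 2)]
    linarith [Real.pi_lt_four]
  -- `e^{9/(8L²)} ≤ e^{1/2} < 1.65`
  have hexp : Real.exp (9 / (8 * L₂ ^ 2)) < 1.65 := by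
    have h4 : 4 ≤ L₂ ^ 2 := by nlinarith
    have hle : 9 / (8 * L₂ ^ 2) ≤ 1 / 2 := by
      rw [div_le_iff₀ (by positivity)]
      linarith
    have he : Real.exp (1 / 2) < 1.65 := by
      have hsq : Real.exp (1 / 2) ^ 2 = Real.exp 1 := by
        rw [← Real.exp_nat_mul]; norm_num
      have h1 : Real.exp 1 < 2.7182818286 := Real.exp_one_lt_d9
      nlinarith [Real.exp_pos (1 / 2 : ℝ)]
    exact (Real.exp_le_exp.mpr hle).trans_lt he
  have hL2 : 0 < L₂ ^ 2 := by positivity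
  rw [div_le_div_iff_of_pos_right hL2]
  have h1 : 8 * π * Real.sqrt π * Real.exp (9 / (8 * L₂ ^ 2)) ≤ 8 * 3.15 * 2 * 1.65 := by
    have := Real.sqrt_nonneg π
    have := (Real.exp_pos (9 / (8 * L₂ ^ 2))).le
    gcongr
  linarith

/-! ### Lipschitz and discrete-variation forms (the shapes the window lemmas consume) -/

/-- **Lipschitz form:** `‖Δ(z) − Δ(y)‖ ≤ (84/L²)·|z − y|` for `L ≥ 2` (mean value inequality).
[cite: Zhang2022LandauSiegel, §5 (5.10), Lemma 5.4 (proof); §7 (7.18)–(7.21)] -/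
theorem norm_Delta510_sub_le {L₂ : ℝ} (hL : 2 ≤ L₂) (t₀ y z : ℝ) :
    ‖Delta510 L₂ t₀ z - Delta510 L₂ t₀ y‖ ≤ 84 / L₂ ^ 2 * |z - y| := by
  have hL0 : L₂ ≠ 0 := by positivity
  have h := Convex.norm_image_sub_le_of_norm_deriv_le (f := Delta510 L₂ t₀) (s := Set.univ)
    (fun x _ => (hasDerivAt_Delta510 hL0 t₀ x).differentiableAt)
    (fun x _ => norm_deriv_Delta510_le_of_two_le hL t₀ x) convex_univ (Set.mem_univ y) (Set.mem_univ z)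
  rwa [Real.norm_eq_abs] at h

/-- **Discrete-variation form** (the hypothesis shape `hGv`/`hFv` of `WindowHyperbola.norm_window_chi_conv_le` for
the weight `n ↦ Δ(c·n)`): for `L ≥ 2`, every step `c` and all `N′, M′`,
`Σ_{n ∈ Ioo N′ M′} ‖Δ(c·n) − Δ(c·(n+1))‖ ≤ (84/L²)·|c|·#Ioo N′ M′`. In the cell (`c = l₁/(pk)`, `#Ioo ≤ 2𝓛₁pk/l₁`):
`TV ≤ 168·𝓛₁/𝓛₂²`. [cite: Zhang2022LandauSiegel, §5 (5.10); §7 (7.17)–(7.21) p. 15] -/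
theorem sum_norm_Delta510_sample_sub_le {L₂ : ℝ} (hL : 2 ≤ L₂) (t₀ c : ℝ) (N' M' : ℕ) :
    ∑ n ∈ Finset.Ioo N' M', ‖Delta510 L₂ t₀ (c * n) - Delta510 L₂ t₀ (c * (n + 1))‖ ≤
      84 / L₂ ^ 2 * |c| * ((Finset.Ioo N' M').card : ℝ) := by
  have hterm : ∀ n ∈ Finset.Ioo N' M',
      ‖Delta510 L₂ t₀ (c * n) - Delta510 L₂ t₀ (c * (n + 1))‖ ≤ 84 / L₂ ^ 2 * |c| := by
    intro n _
    have h := norm_Delta510_sub_le hL t₀ (c * (n + 1)) (c * n)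
    have hc : |c * (n : ℝ) - c * (n + 1)| = |c| := by
      rw [show c * (n : ℝ) - c * (n + 1) = -c by ring, abs_neg]
    rwa [hc] at h
  calc ∑ n ∈ Finset.Ioo N' M', ‖Delta510 L₂ t₀ (c * n) - Delta510 L₂ t₀ (c * (n + 1))‖
      ≤ ∑ _n ∈ Finset.Ioo N' M', 84 / L₂ ^ 2 * |c| := Finset.sum_le_sum hterm
    _ = 84 / L₂ ^ 2 * |c| * ((Finset.Ioo N' M').card : ℝ) := by
        rw [Finset.sum_const, nsmul_eq_mul]; ring

end Lemma53

end Literature.NumberTheory.LFunctions.Zhang2022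

end
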